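import Mathlib
import HarnessLib

/-!
# Crux `DigitPolyUniformity` (stmt-QuantumAdvantage-1392), line `Sketch`, cycle 6 — Stub G1

Periodic defect count: for `f` of period `2^K` the condition `f (p m) = f m` depends only on `m mod 2^K`,
and every residue class modulo `2^K` meets `[1, X)` in at most `X / 2^K + 1` points.  Hence
`#{1 ≤ m < X : f (p m) = f m} ≤ (X / 2^K + 1) · #{r < 2^K : f (p r) = f r}`.
-/

noncomputable section

namespace Summit.QuantumAdvantage.DigitPolyUniformity.SketchLAR.Chirp

open Finset

/-- **Stub G1 (periodic defect count).** For `f` of period `2^K` the condition `f(pm) = f(m)` depends only on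
`m mod 2^K`, and every class meets `[1, X)` in at most `X/2^K + 1` points. [folklore] -/
theorem stub_defect_periodic (f : ℕ → ℝ) (K p X : ℕ) (hper : ∀ r, f (r % 2 ^ K) = f r) :
    ((Ico 1 X).filter (fun m => f (p * m) = f m)).card ≤
      (X / 2 ^ K + 1) * ((range (2 ^ K)).filter (fun r => f (p * r) = f r)).card := by
  set S := (Ico 1 X).filter (fun m => f (p * m) = f m) with hS
  -- the reduction `m ↦ m % 2^K` maps `S` into the set of defects below `2^K`
  have himg : S.image (fun m => m % 2 ^ K) ⊆ (range (2 ^ K)).filter (fun r => f (p * r) = f r) := by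
    intro r hr
    rw [Finset.mem_image] at hr
    obtain ⟨m, hm, rfl⟩ := hr
    rw [hS, Finset.mem_filter] at hm
    rw [Finset.mem_filter, Finset.mem_range]
    refine ⟨Nat.mod_lt _ (Nat.two_pow_pos K), ?_⟩
    have h1 : f (p * (m % 2 ^ K)) = f (p * m) := by
      rw [← hper (p * (m % 2 ^ K)), Nat.mul_mod_mod, hper]
    rw [h1, hm.2, hper]
  -- every fibre of the reduction has at most `X / 2^K + 1` elements
  have hfib : ∀ r ∈ S.image (fun m => m % 2 ^ K),
      (S.filter (fun m => m % 2 ^ K = r)).card ≤ X / 2 ^ K + 1 := by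
    intro r _
    calc (S.filter (fun m => m % 2 ^ K = r)).card
        ≤ (range (X / 2 ^ K + 1)).card := by
          refine Finset.card_le_card_of_injOn (fun m => m / 2 ^ K) ?_ ?_
          · intro m hm
            rw [Finset.mem_coe, Finset.mem_filter, hS, Finset.mem_filter, Finset.mem_Ico] at hm
            rw [Finset.mem_coe, Finset.mem_range, Nat.lt_succ_iff]
            exact Nat.div_le_div_right hm.1.1.2.le
          · intro m₁ hm₁ m₂ hm₂ h
            rw [Finset.mem_coe, Finset.mem_filter] at hm₁ hm₂
            simp only at h
            rw [← Nat.div_add_mod m₁ (2 ^ K), ← Nat.div_add_mod m₂ (2 ^ K), h, hm₁.2, hm₂.2]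
      _ = X / 2 ^ K + 1 := Finset.card_range _
  calc S.card ≤ (X / 2 ^ K + 1) * (S.image (fun m => m % 2 ^ K)).card :=
        Finset.card_le_mul_card_image S _ hfib
    _ ≤ (X / 2 ^ K + 1) * ((range (2 ^ K)).filter (fun r => f (p * r) = f r)).card :=
        Nat.mul_le_mul_left _ (Finset.card_le_card himg)

end Summit.QuantumAdvantage.DigitPolyUniformity.SketchLAR.Chirp

end
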